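import Literature.Geometry.Lorentzian.KerrOblateCalculus
import Literature.Geometry.Lorentzian.KerrSchildBox
import HarnessLib

/-!
# Separation of variables for axisymmetric profiles `F(r) S(χ)` on the Kerr–Schild chart

(family `gr`; namespace `Literature.Geometry.Lorentzian.Kerr`)

For complex functions `F, S : ℝ → ℂ` the **separated axisymmetric profile**
`Φ(x) = F(r(x)) S(χ(x))` (`Kerr.sepProfile`; `r` the Kerr–Schild radius, `χ = z/r = cos θ` the
latitude of `KerrOblateCalculus.lean`) is stationary, and at every point with `r > 0` where `F`, `S`
are twice differentiable its derivatives along the null vector `ℓ♯` and its flat spatial Laplacian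
are (`∂_{ℓ♯} r = 1`, `∂_{ℓ♯}χ = 0`, `∂²_{ℓ♯ℓ♯} r = ∂²_{ℓ♯ℓ♯}χ = 0`, `|∇r|² = (r²+a²)/Σ`, `∇r·∇χ = 0`,
`|∇χ|² = (1−χ²)/Σ`, `Δr = 2r/Σ`, `Δχ = −2χ/Σ`):

* `fderiv_sepProfile_nullVector`: `∂_{ℓ♯}Φ = F'(r) S(χ)`;
* `fderiv_fderiv_sepProfile_nullVector`: `∂²_{ℓ♯ℓ♯}Φ = F''(r) S(χ)`;
* `laplacian_sepProfile`: `ΔΦ = [((r²+a²)F'' + 2rF') S + F ((1−χ²)S'' − 2χS')]/Σ`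
  — the flat Laplacian in oblate spheroidal coordinates on axisymmetric functions;
* `ksBoxC_timeHarmonic_sepProfile`: consequently, for the time-harmonic field
  `Ψ = e^{−iωt_KS} F(r) S(χ)` the Kerr–Schild wave operator of `KerrSchildBox.lean` is
  `Σ · ksBoxC Ψ = e^{−iωt_KS} ( S · 𝓡_ω[F] + F · 𝓐[S] + ω² a²χ² F S )` with the **radial operator**
  `𝓡_ω[F] = Δ_r F'' + (2r − 2M − 4iMωr) F' + (ω² r² + 2Mrω² − 2iMω) F`, `Δ_r = r² − 2Mr + a²`, and the
  **angular operator** `𝓐[S] = (1 − χ²)S'' − 2χS'` — i.e. `(□_g − μ²)Ψ = 0` separates into the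
  axisymmetric spheroidal equation `𝓐[S] + (λ − a²(μ²−ω²)χ²)S = 0` and the radial equation
  `𝓡_ω[F] = (λ + μ²r²)F` (`ksBoxC_sepProfile_eq_of_ode`). This is Carter's separation of the
  Klein–Gordon equation on Kerr for azimuthal number `m = 0`, written in the ingoing (horizon-regular)
  Kerr–Schild gauge: Shlapentokh-Rothman, CMP 329 (2014), §2, eqs. for `S_{0l}` and `R` (in
  Boyer–Lindquist form `Δ(ΔR')' − V_μ R = 0`; the present `F` is `e^{−iω t̄(r)} R`, smooth at `r₊`,
  cf. loc. cit. (2.3)); Brill–Chrzanowski–Pereira–Fackerell–Ipser, Phys. Rev. D 5 (1972) (Teukolsky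
  `s = 0`).

## References

* Y. Shlapentokh-Rothman, Comm. Math. Phys. 329 (2014) 859–891, §2 (key
  `ShlapentokhRothman2014KleinGordon`).
* M. Visser, arXiv:0706.0622, (33)–(36) (key `arXiv07060622`).
-/

noncomputable section

open Set Filter
open scoped Topology

namespace Literature.Geometry.Lorentzian.Kerr

variable {a : ℝ} {x : E4}

/-! ### The separated profile and its first derivatives -/

/-- The **separated axisymmetric profile** `Φ(x) = F(r(x)) · S(χ(x))` built from a radial factor `F`
and an angular factor `S` (functions of the Kerr–Schild radius and of the latitude `χ = cos θ`).
SR, CMP 329 (2014), §1.3 (1.5) with `m = 0`. [cite: ShlapentokhRothman2014KleinGordon, §1.3 (1.5)] -/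
def sepProfile (a : ℝ) (F S : ℝ → ℂ) (x : E4) : ℂ := F (radius a x) * S (latitude a x)

variable {F F₁ F₂ S S₁ S₂ : ℝ → ℂ}

/-- The separated profile is stationary (`r` and `χ` do not depend on `t_KS`). [folklore] -/
theorem isStationaryField_sepProfile (a : ℝ) (F S : ℝ → ℂ) : IsStationaryField (sepProfile a F S) := by
  intro y s
  simp only [sepProfile, radius_add_time_smul_basisVector, latitude_add_smul_basisVector_zero]

/-- A real derivative `dR` made complex: `v ↦ (dR v : ℂ)`. [folklore] -/
def clmC (L : E4 →L[ℝ] ℝ) : E4 →L[ℝ] ℂ := Complex.ofRealCLM.comp L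

/-- `clmC L v = L v`. [folklore] -/
@[simp]
theorem clmC_apply (L : E4 →L[ℝ] ℝ) (v : E4) : clmC L v = ((L v : ℝ) : ℂ) := rfl

/-- Chain rule for a complex function of a real scalar field: if `f` has derivative `f'` at `y` and
`G : ℝ → ℂ` has derivative `c` at `f y`, then `D(G ∘ f)(y) = c · f'`. [folklore] -/
theorem hasFDerivAt_comp_real {f : E4 → ℝ} {f' : E4 →L[ℝ] ℝ} {G : ℝ → ℂ} {c : ℂ} {y : E4}
    (hG : HasDerivAt G c (f y)) (hf : HasFDerivAt f f' y) :
    HasFDerivAt (fun z ↦ G (f z)) (c • clmC f') y := by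
  have h := hG.hasFDerivAt.comp y hf
  refine h.congr_fderiv ?_
  ext v
  simp [clmC, mul_comm]

/-- **First derivative of the separated profile**: at a point `y` with `r > 0` where `F` and `S`
are differentiable (derivatives `F₁(r)`, `S₁(χ)`),
`DΦ(y) v = F₁(r) S(χ) dr(v) + F(r) S₁(χ) dχ(v)`. [folklore] -/
theorem hasFDerivAt_sepProfile {y : E4} (hy : 0 < radius a y)
    (hF : HasDerivAt F (F₁ (radius a y)) (radius a y))
    (hS : HasDerivAt S (S₁ (latitude a y)) (latitude a y)) :
    HasFDerivAt (sepProfile a F S)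
      ((F₁ (radius a y) * S (latitude a y)) • clmC (fderiv ℝ (radius a) y) +
        (F (radius a y) * S₁ (latitude a y)) • clmC (fderiv ℝ (latitude a) y)) y := by
  have hR : HasFDerivAt (radius a) (fderiv ℝ (radius a) y) y :=
    ((contDiffAt_radius hy (n := 1)).differentiableAt one_ne_zero).hasFDerivAt
  have hL : HasFDerivAt (latitude a) (fderiv ℝ (latitude a) y) y :=
    ((contDiffAt_latitude hy (n := 1)).differentiableAt one_ne_zero).hasFDerivAt
  have h1 := hasFDerivAt_comp_real hF hR
  have h2 := hasFDerivAt_comp_real hS hL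
  have h := h1.mul h2
  refine h.congr_fderiv ?_
  ext v
  simp only [add_apply, smul_apply, smul_eq_mul, clmC_apply]
  ring

/-- The first derivative in a direction `v`. [folklore] -/
theorem fderiv_sepProfile_apply {y : E4} (hy : 0 < radius a y)
    (hF : HasDerivAt F (F₁ (radius a y)) (radius a y))
    (hS : HasDerivAt S (S₁ (latitude a y)) (latitude a y)) (v : E4) :
    fderiv ℝ (sepProfile a F S) y v =
      F₁ (radius a y) * S (latitude a y) * fderiv ℝ (radius a) y v +
        F (radius a y) * S₁ (latitude a y) * fderiv ℝ (latitude a) y v := by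
  rw [(hasFDerivAt_sepProfile hy hF hS).fderiv]
  simp only [add_apply, smul_apply, smul_eq_mul, clmC_apply]

/-- **`∂_{ℓ♯}Φ = F₁(r) S(χ)`** (`∂_{ℓ♯} r = 1`, `∂_{ℓ♯} χ = 0`). [cite: KerrSchild1965, §2] -/
theorem fderiv_sepProfile_nullVector {y : E4} (hy : 0 < radius a y)
    (hF : HasDerivAt F (F₁ (radius a y)) (radius a y))
    (hS : HasDerivAt S (S₁ (latitude a y)) (latitude a y)) :
    fderiv ℝ (sepProfile a F S) y (nullVector a y) = F₁ (radius a y) * S (latitude a y) := by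
  rw [fderiv_sepProfile_apply hy hF hS, fderiv_radius_nullVector hy, fderiv_latitude_nullVector hy]
  push_cast
  ring

/-! ### Second derivatives: along `ℓ♯` and the flat Laplacian -/

section Second

variable (hx : 0 < radius a x)
  (hF : ∀ᶠ ρ in 𝓝 (radius a x), HasDerivAt F (F₁ ρ) ρ)
  (hF₁ : HasDerivAt F₁ (F₂ (radius a x)) (radius a x))
  (hS : ∀ᶠ c in 𝓝 (latitude a x), HasDerivAt S (S₁ c) c)
  (hS₁ : HasDerivAt S₁ (S₂ (latitude a x)) (latitude a x))
  (hΦ : ContDiffAt ℝ 2 (sepProfile a F S) x)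
include hx hF hF₁ hS hS₁ hΦ

omit hF₁ hS₁ hΦ in
/-- Along any line through `x`, the hypotheses at `x` propagate: near `s = 0` the point `x + sv` has
`r > 0` and `F`, `S` are differentiable at `r(x + sv)`, `χ(x + sv)`. [folklore] -/
theorem eventually_line (v : E4) : ∀ᶠ s : ℝ in 𝓝 0, 0 < radius a (x + s • v) ∧
    HasDerivAt F (F₁ (radius a (x + s • v))) (radius a (x + s • v)) ∧
    HasDerivAt S (S₁ (latitude a (x + s • v))) (latitude a (x + s • v)) := by
  have hcr : Tendsto (fun s : ℝ ↦ radius a (x + s • v)) (𝓝 0) (𝓝 (radius a x)) := by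
    have := (hasDerivAt_radius_line hx v).continuousAt.tendsto
    simpa using this
  have hcl : Tendsto (fun s : ℝ ↦ latitude a (x + s • v)) (𝓝 0) (𝓝 (latitude a x)) := by
    have := (hasDerivAt_latitude_line hx v).continuousAt.tendsto
    simpa using this
  filter_upwards [eventually_radius_line_pos hx v, hcr.eventually hF, hcl.eventually hS] with s h1 h2 h3
  exact ⟨h1, h2, h3⟩

omit hx hF hF₁ hS hS₁ in
/-- `y ↦ DΦ(y) w` is differentiable at `x` (Φ is `C²` there). [folklore] -/
theorem differentiableAt_fderiv_sepProfile_apply (w : E4) :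
    DifferentiableAt ℝ (fun y ↦ fderiv ℝ (sepProfile a F S) y w) x := by
  have h2 : DifferentiableAt ℝ (fderiv ℝ (sepProfile a F S)) x :=
    (hΦ.fderiv_right (m := 1) le_rfl).differentiableAt one_ne_zero
  exact h2.clm_apply (differentiableAt_const w)

omit hS₁ in
/-- **`∂²_{ℓ♯ℓ♯}Φ = F₂(r) S(χ)`**: along the null line `∂_{ℓ♯}Φ = F₁(r + s) S(χ)`. [cite: KerrSchild1965, §2] -/
theorem fderiv_fderiv_sepProfile_nullVector :
    fderiv ℝ (fun y ↦ fderiv ℝ (sepProfile a F S) y (nullVector a x)) x (nullVector a x) =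
      F₂ (radius a x) * S (latitude a x) := by
  have h1 : HasLineDerivAt ℝ (fun y ↦ fderiv ℝ (sepProfile a F S) y (nullVector a x))
      (fderiv ℝ (fun y ↦ fderiv ℝ (sepProfile a F S) y (nullVector a x)) x (nullVector a x)) x
      (nullVector a x) :=
    (differentiableAt_fderiv_sepProfile_apply hΦ _).hasFDerivAt.hasLineDerivAt _
  refine h1.unique ?_
  show HasDerivAt (fun s : ℝ ↦ fderiv ℝ (sepProfile a F S) (x + s • nullVector a x) (nullVector a x)) _ 0
  have hev : (fun s : ℝ ↦ fderiv ℝ (sepProfile a F S) (x + s • nullVector a x) (nullVector a x))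
      =ᶠ[𝓝 0] fun s ↦ F₁ (radius a x + s) * S (latitude a x) := by
    filter_upwards [eventually_line hx hF hS (nullVector a x),
      eventually_radius_add_pos hx] with s hs hs'
    obtain ⟨hpos, hFs, hSs⟩ := hs
    have := fderiv_sepProfile_nullVector hpos hFs hSs
    rwa [nullVector_add_smul_nullVector hx hs', radius_add_smul_nullVector hx hs',
      latitude_add_smul_nullVector hx hs'] at this
  have hline : HasDerivAt (fun s : ℝ ↦ F₁ (radius a x + s) * S (latitude a x))
      (F₂ (radius a x) * S (latitude a x)) 0 := by
    have h := hF₁.scomp_of_eq 0 ((hasDerivAt_id (0 : ℝ)).const_add (radius a x)) (by simp)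
    have h' : HasDerivAt (fun s : ℝ ↦ F₁ (radius a x + s)) (F₂ (radius a x)) 0 := by
      simpa [Function.comp_def] using h
    simpa using h'.mul_const (S (latitude a x))
  exact hline.congr_of_eventuallyEq hev

omit hS₁ in
/-- `D²Φ(ℓ♯, ℓ♯) = F₂(r) S(χ)` in Fréchet form. [cite: KerrSchild1965, §2] -/
theorem fderiv_fderiv_sepProfile_nullVector_nullVector :
    fderiv ℝ (fderiv ℝ (sepProfile a F S)) x (nullVector a x) (nullVector a x) =
      F₂ (radius a x) * S (latitude a x) := by
  have h2 : DifferentiableAt ℝ (fderiv ℝ (sepProfile a F S)) x :=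
    (hΦ.fderiv_right (m := 1) le_rfl).differentiableAt one_ne_zero
  have hclm : fderiv ℝ (fderiv ℝ (sepProfile a F S)) x (nullVector a x) (nullVector a x) =
      fderiv ℝ (fun y ↦ fderiv ℝ (sepProfile a F S) y (nullVector a x)) x (nullVector a x) := by
    have := h2.hasFDerivAt.clm_apply (hasFDerivAt_const (nullVector a x) x)
    rw [this.fderiv]
    simp
  rw [hclm]
  exact fderiv_fderiv_sepProfile_nullVector hx hF hF₁ hS hΦ

omit hΦ in
/-- **The second partial `∂_{i+1}∂_{i+1}Φ` as a line derivative.** Along `s ↦ x + s∂_{i+1}`,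
`∂_{i+1}Φ = F₁(r)S(χ) gᵢ + F(r)S₁(χ) hᵢ` (`gᵢ = ∂_{i+1}r`, `hᵢ = ∂_{i+1}χ`) has `s`-derivative
`F₂ S gᵢ² + 2 F₁ S₁ gᵢ hᵢ + F₁ S vᵢ + F S₂ hᵢ² + F S₁ wᵢ` (`vᵢ = ∂²_{i+1} r`, `wᵢ = ∂²_{i+1} χ`).
[folklore] -/
theorem hasDerivAt_fderiv_sepProfile_line (i : Fin 3) :
    HasDerivAt (fun s : ℝ ↦ fderiv ℝ (sepProfile a F S) (x + s • E4.basisVector i.succ)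
      (E4.basisVector i.succ))
      (F₂ (radius a x) * S (latitude a x) * fderiv ℝ (radius a) x (E4.basisVector i.succ) ^ 2 +
        2 * F₁ (radius a x) * S₁ (latitude a x) * fderiv ℝ (radius a) x (E4.basisVector i.succ) *
          fderiv ℝ (latitude a) x (E4.basisVector i.succ) +
        F₁ (radius a x) * S (latitude a x) *
          fderiv ℝ (fun y ↦ fderiv ℝ (radius a) y (E4.basisVector i.succ)) x (E4.basisVector i.succ) +
        F (radius a x) * S₂ (latitude a x) * fderiv ℝ (latitude a) x (E4.basisVector i.succ) ^ 2 +
        F (radius a x) * S₁ (latitude a x) *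
          fderiv ℝ (fun y ↦ fderiv ℝ (latitude a) y (E4.basisVector i.succ)) x (E4.basisVector i.succ))
      0 := by
  have hr := hasDerivAt_radius_line hx (E4.basisVector i.succ)
  have hl := hasDerivAt_latitude_line hx (E4.basisVector i.succ)
  have hg := hasDerivAt_fderiv_radius_line hx i
  rw [← fderiv_fderiv_radius_basisVector_succ hx i] at hg
  have hh := hasDerivAt_fderiv_latitude_line hx i
  rw [← fderiv_fderiv_latitude_basisVector_succ hx i] at hh
  have hF0 : HasDerivAt F (F₁ (radius a x)) (radius a x) := hF.self_of_nhds
  have hS0 : HasDerivAt S (S₁ (latitude a x)) (latitude a x) := hS.self_of_nhds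
  -- the explicit first partial along the line
  have hev : (fun s : ℝ ↦ fderiv ℝ (sepProfile a F S) (x + s • E4.basisVector i.succ)
      (E4.basisVector i.succ)) =ᶠ[𝓝 0] fun s ↦
      F₁ (radius a (x + s • E4.basisVector i.succ)) * S (latitude a (x + s • E4.basisVector i.succ)) *
        fderiv ℝ (radius a) (x + s • E4.basisVector i.succ) (E4.basisVector i.succ) +
      F (radius a (x + s • E4.basisVector i.succ)) * S₁ (latitude a (x + s • E4.basisVector i.succ)) *
        fderiv ℝ (latitude a) (x + s • E4.basisVector i.succ) (E4.basisVector i.succ) := by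
    filter_upwards [eventually_line hx hF hS (E4.basisVector i.succ)] with s hs
    obtain ⟨hpos, hFs, hSs⟩ := hs
    have := fderiv_sepProfile_apply hpos hFs hSs (E4.basisVector i.succ)
    exact_mod_cast this
  -- the factors along the line
  have hr0 : radius a x = radius a (x + (0 : ℝ) • E4.basisVector i.succ) := by simp
  have hl0 : latitude a x = latitude a (x + (0 : ℝ) • E4.basisVector i.succ) := by simp
  have hFr : HasDerivAt (fun s : ℝ ↦ F (radius a (x + s • E4.basisVector i.succ)))
      (fderiv ℝ (radius a) x (E4.basisVector i.succ) • F₁ (radius a x)) 0 := by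
    have := hF0.scomp_of_eq 0 hr hr0
    simpa [Function.comp_def] using this
  have hF₁r : HasDerivAt (fun s : ℝ ↦ F₁ (radius a (x + s • E4.basisVector i.succ)))
      (fderiv ℝ (radius a) x (E4.basisVector i.succ) • F₂ (radius a x)) 0 := by
    have := hF₁.scomp_of_eq 0 hr hr0
    simpa [Function.comp_def] using this
  have hSl : HasDerivAt (fun s : ℝ ↦ S (latitude a (x + s • E4.basisVector i.succ)))
      (fderiv ℝ (latitude a) x (E4.basisVector i.succ) • S₁ (latitude a x)) 0 := by
    have := hS0.scomp_of_eq 0 hl hl0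
    simpa [Function.comp_def] using this
  have hS₁l : HasDerivAt (fun s : ℝ ↦ S₁ (latitude a (x + s • E4.basisVector i.succ)))
      (fderiv ℝ (latitude a) x (E4.basisVector i.succ) • S₂ (latitude a x)) 0 := by
    have := hS₁.scomp_of_eq 0 hl hl0
    simpa [Function.comp_def] using this
  have hgC : HasDerivAt (fun s : ℝ ↦ ((fderiv ℝ (radius a) (x + s • E4.basisVector i.succ)
      (E4.basisVector i.succ) : ℝ) : ℂ))
      ((fderiv ℝ (fun y ↦ fderiv ℝ (radius a) y (E4.basisVector i.succ)) x (E4.basisVector i.succ) :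
        ℝ) : ℂ) 0 := hg.ofReal_comp
  have hhC : HasDerivAt (fun s : ℝ ↦ ((fderiv ℝ (latitude a) (x + s • E4.basisVector i.succ)
      (E4.basisVector i.succ) : ℝ) : ℂ))
      ((fderiv ℝ (fun y ↦ fderiv ℝ (latitude a) y (E4.basisVector i.succ)) x (E4.basisVector i.succ) :
        ℝ) : ℂ) 0 := hh.ofReal_comp
  have hsum := ((hF₁r.mul hSl).mul hgC).add ((hFr.mul hS₁l).mul hhC)
  refine (hsum.congr_of_eventuallyEq hev).congr_deriv ?_
  simp only [Pi.mul_apply, zero_smul, add_zero, Complex.real_smul]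
  ring

/-- **`∂_{i+1}∂_{i+1}Φ`** wherever `r > 0` (uniqueness of line derivatives). [folklore] -/
theorem fderiv_fderiv_sepProfile_basisVector_succ (i : Fin 3) :
    fderiv ℝ (fun y ↦ fderiv ℝ (sepProfile a F S) y (E4.basisVector i.succ)) x (E4.basisVector i.succ) =
      F₂ (radius a x) * S (latitude a x) * fderiv ℝ (radius a) x (E4.basisVector i.succ) ^ 2 +
        2 * F₁ (radius a x) * S₁ (latitude a x) * fderiv ℝ (radius a) x (E4.basisVector i.succ) *
          fderiv ℝ (latitude a) x (E4.basisVector i.succ) +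
        F₁ (radius a x) * S (latitude a x) *
          fderiv ℝ (fun y ↦ fderiv ℝ (radius a) y (E4.basisVector i.succ)) x (E4.basisVector i.succ) +
        F (radius a x) * S₂ (latitude a x) * fderiv ℝ (latitude a) x (E4.basisVector i.succ) ^ 2 +
        F (radius a x) * S₁ (latitude a x) *
          fderiv ℝ (fun y ↦ fderiv ℝ (latitude a) y (E4.basisVector i.succ)) x (E4.basisVector i.succ) := by
  have h1 : HasLineDerivAt ℝ (fun y ↦ fderiv ℝ (sepProfile a F S) y (E4.basisVector i.succ))
      (fderiv ℝ (fun y ↦ fderiv ℝ (sepProfile a F S) y (E4.basisVector i.succ)) x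
        (E4.basisVector i.succ)) x (E4.basisVector i.succ) :=
    (differentiableAt_fderiv_sepProfile_apply hΦ _).hasFDerivAt.hasLineDerivAt _
  exact h1.unique (hasDerivAt_fderiv_sepProfile_line hx hF hF₁ hS hS₁ i)

/-- **The flat Laplacian of a separated axisymmetric profile** (oblate spheroidal coordinates):
`ΔΦ = ∑ᵢ ∂_{i+1}∂_{i+1}Φ = [((r² + a²)F₂ + 2rF₁) S + F ((1 − χ²)S₂ − 2χS₁)]/Σ`, from
`|∇r|² = (r²+a²)/Σ`, `∇r·∇χ = 0`, `Δr = 2r/Σ`, `|∇χ|² = (1−χ²)/Σ`, `Δχ = −2χ/Σ`.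
Flammer 1957, Ch. 2 (Laplacian in spheroidal coordinates); SR, CMP 329 (2014), §2.
[cite: ShlapentokhRothman2014KleinGordon, §2] -/
theorem laplacian_sepProfile :
    ∑ i : Fin 3, fderiv ℝ (fderiv ℝ (sepProfile a F S)) x (E4.basisVector i.succ) (E4.basisVector i.succ) =
      (((radius a x ^ 2 + a ^ 2) * F₂ (radius a x) + 2 * radius a x * F₁ (radius a x)) *
          S (latitude a x) +
        F (radius a x) * ((1 - latitude a x ^ 2) * S₂ (latitude a x) -
          2 * latitude a x * S₁ (latitude a x))) / blSigma a (E4.spatial x) := by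
  have hS0 : (blSigma a (E4.spatial x) : ℂ) ≠ 0 := by exact_mod_cast (blSigma_spatial_pos hx).ne'
  have hclm : ∀ i : Fin 3, fderiv ℝ (fderiv ℝ (sepProfile a F S)) x (E4.basisVector i.succ)
      (E4.basisVector i.succ) = fderiv ℝ (fun y ↦ fderiv ℝ (sepProfile a F S) y (E4.basisVector i.succ))
        x (E4.basisVector i.succ) := by
    intro i
    have h2 : DifferentiableAt ℝ (fderiv ℝ (sepProfile a F S)) x :=
      (hΦ.fderiv_right (m := 1) le_rfl).differentiableAt one_ne_zero
    have := h2.hasFDerivAt.clm_apply (hasFDerivAt_const (E4.basisVector i.succ) x)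
    rw [this.fderiv]
    simp
  simp only [hclm, fderiv_fderiv_sepProfile_basisVector_succ hx hF hF₁ hS hS₁ hΦ]
  -- regroup the sum and insert the five identities
  have hG := congrArg (fun t : ℝ ↦ (t : ℂ)) (sum_sq_fderiv_radius hx)
  have hperp := congrArg (fun t : ℝ ↦ (t : ℂ)) (sum_fderiv_radius_mul_fderiv_latitude hx)
  have hΔr := congrArg (fun t : ℝ ↦ (t : ℂ)) (laplacian_radius hx)
  have hL := congrArg (fun t : ℝ ↦ (t : ℂ)) (sum_sq_fderiv_latitude hx)
  have hΔl := congrArg (fun t : ℝ ↦ (t : ℂ)) (laplacian_latitude hx)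
  simp only [Fin.sum_univ_three] at hG hperp hΔr hL hΔl ⊢
  push_cast at hG hperp hΔr hL hΔl ⊢
  rw [eq_div_iff hS0] at hG hΔr hL hΔl ⊢
  linear_combination (F₂ (radius a x) * S (latitude a x)) * hG +
    (2 * F₁ (radius a x) * S₁ (latitude a x) * (blSigma a (E4.spatial x) : ℂ)) * hperp +
    (F₁ (radius a x) * S (latitude a x)) * hΔr +
    (F (radius a x) * S₂ (latitude a x)) * hL +
    (F (radius a x) * S₁ (latitude a x)) * hΔl

/-! ### The Kerr–Schild wave operator on `e^{−iωt} F(r) S(χ)`: separation into radial and angular parts -/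

omit hF hF₁ hS hS₁ hΦ in
/-- `Σ = r² + a²χ²` (`r²Σ = r⁴ + a²z²`, `χ = z/r`). [cite: arXiv07060622, (33)–(35)] -/
theorem blSigma_eq_sq_add_sq_mul_sq_latitude :
    blSigma a (E4.spatial x) = radius a x ^ 2 + a ^ 2 * latitude a x ^ 2 := by
  have h := sq_mul_blSigma_spatial a x
  have hr : radius a x ≠ 0 := hx.ne'
  have hr2 : radius a x ^ 2 ≠ 0 := pow_ne_zero 2 hr
  rw [latitude, div_pow]
  field_simp
  linear_combination h

/-- **Separation of the Kerr–Schild wave operator on `Ψ = e^{−iωt_KS} F(r) S(χ)`.** At a point with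
`r > 0` where `F`, `S` are twice differentiable,
`Σ · ksBoxC Ψ = e^{−iωt_KS} ( S 𝓡_ω[F] + F 𝓐[S] + ω² a² χ² F S )`, with the radial operator
`𝓡_ω[F] = (r² − 2Mr + a²) F'' + (2r − 2M − 4iMωr) F' + (ω² r² + 2Mrω² − 2iMω) F` (ingoing
Kerr–Schild gauge) and the angular operator `𝓐[S] = (1 − χ²) S'' − 2χ S'`
(`ksBoxC_timeHarmonic` with `∂_{ℓ♯}Φ = F'S`, `∂²_{ℓ♯ℓ♯}Φ = F''S`, `laplacian_sepProfile`, `H = Mr/Σ`,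
`Σ = r² + a²χ²`). SR, CMP 329 (2014), §2 (the separated equations, `m = 0`).
[cite: ShlapentokhRothman2014KleinGordon, §2] -/
theorem blSigma_mul_ksBoxC_sepProfile (M : ℝ) (w : ℂ) :
    (blSigma a (E4.spatial x) : ℂ) * ksBoxC M a (fun y ↦ phase w y * sepProfile a F S y) x =
      phase w x *
        (S (latitude a x) *
            (((radius a x : ℂ) ^ 2 - 2 * M * radius a x + a ^ 2) * F₂ (radius a x) +
              (2 * radius a x - 2 * M - 4 * Complex.I * M * w * radius a x) * F₁ (radius a x) +
              (w ^ 2 * radius a x ^ 2 + 2 * M * radius a x * w ^ 2 - 2 * Complex.I * M * w) *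
                F (radius a x)) +
          F (radius a x) *
            ((1 - (latitude a x : ℂ) ^ 2) * S₂ (latitude a x) - 2 * latitude a x * S₁ (latitude a x)) +
          w ^ 2 * a ^ 2 * latitude a x ^ 2 * F (radius a x) * S (latitude a x)) := by
  have hS0 : (blSigma a (E4.spatial x) : ℂ) ≠ 0 := by exact_mod_cast (blSigma_spatial_pos hx).ne'
  have hF0 : HasDerivAt F (F₁ (radius a x)) (radius a x) := hF.self_of_nhds
  have hSl0 : HasDerivAt S (S₁ (latitude a x)) (latitude a x) := hS.self_of_nhds
  have hH : (scalarH M a x : ℂ) = M * radius a x / blSigma a (E4.spatial x) := by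
    rw [scalarH_eq_div_blSigma M a hx]
    push_cast
    rfl
  have hSig := congrArg (fun t : ℝ ↦ (t : ℂ)) (blSigma_eq_sq_add_sq_mul_sq_latitude hx)
  push_cast at hSig
  rw [ksBoxC_timeHarmonic M a (isStationaryField_sepProfile a F S) x hΦ,
    fderiv_sepProfile_nullVector hx hF0 hSl0,
    fderiv_fderiv_sepProfile_nullVector_nullVector hx hF hF₁ hS hΦ,
    laplacian_sepProfile hx hF hF₁ hS hS₁ hΦ, hH]
  simp only [sepProfile]
  field_simp
  linear_combination (phase w x * w ^ 2 * F (radius a x) * S (latitude a x)) * hSig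

/-- **The separated equations imply the Klein–Gordon equation.** If at the point the angular
factor satisfies the axisymmetric spheroidal equation `(1 − χ²)S'' − 2χS' + (λ − a²(μ² − ω²)χ²)S = 0`
and the radial factor the radial equation `𝓡_ω[F] = (λ + μ² r²) F`, then the time-harmonic separated
field solves `ksBoxC Ψ = μ² Ψ` there (hence `(□_g − μ²) Re Ψ = (□_g − μ²) Im Ψ = 0`,
`dalembertian_re_eq`). SR, CMP 329 (2014), §2. [cite: ShlapentokhRothman2014KleinGordon, §2] -/
theorem ksBoxC_sepProfile_eq_of_ode (M : ℝ) (w lam : ℂ) (μ : ℝ)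
    (hang : (1 - (latitude a x : ℂ) ^ 2) * S₂ (latitude a x) - 2 * latitude a x * S₁ (latitude a x) +
      (lam - a ^ 2 * (μ ^ 2 - w ^ 2) * latitude a x ^ 2) * S (latitude a x) = 0)
    (hrad : ((radius a x : ℂ) ^ 2 - 2 * M * radius a x + a ^ 2) * F₂ (radius a x) +
        (2 * radius a x - 2 * M - 4 * Complex.I * M * w * radius a x) * F₁ (radius a x) +
        (w ^ 2 * radius a x ^ 2 + 2 * M * radius a x * w ^ 2 - 2 * Complex.I * M * w) * F (radius a x) =
      (lam + μ ^ 2 * radius a x ^ 2) * F (radius a x)) :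
    ksBoxC M a (fun y ↦ phase w y * sepProfile a F S y) x =
      (μ : ℂ) ^ 2 * (phase w x * sepProfile a F S x) := by
  have hS0 : (blSigma a (E4.spatial x) : ℂ) ≠ 0 := by exact_mod_cast (blSigma_spatial_pos hx).ne'
  have hSig := congrArg (fun t : ℝ ↦ (t : ℂ)) (blSigma_eq_sq_add_sq_mul_sq_latitude hx)
  push_cast at hSig
  have key := blSigma_mul_ksBoxC_sepProfile hx hF hF₁ hS hS₁ hΦ M w
  refine mul_left_cancel₀ hS0 ?_
  rw [key, sepProfile]
  linear_combination (phase w x * S (latitude a x)) * hrad + (phase w x * F (radius a x)) * hang -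
    (μ ^ 2 * phase w x * F (radius a x) * S (latitude a x)) * hSig

end Second

end Literature.Geometry.Lorentzian.Kerr
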